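import Summits.CriticalPhenomena.SAWScalingLimit.Theorems.SAWDefectDecoherenceDefectDecoherenceSsReduction
import HarnessLib

/-!
# Split of the crux `SAWDefectDecoherence.DefectDecoherence` into four route items
(stmt-CriticalPhenomena-8549; written by crux-strategist s4 as `Cruxes/DefectDecoherence/Lines/split_sector_slaving.lean`,
landed by line lead c4, route `SAWDefectDecoherence`; see `Cruxes/DefectDecoherence/STRATEGY-CENSUS.md` and `SPLIT-READY.md`)

The landed conditional closure of the line `sector-slaving`
(`defectDecoherence_of_sourceLoopBound_of_sources`, `…SsReduction.lean`, lead c2) re-typed so that its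
four hypotheses are spelled over `Literature` declarations only — exactly the statements filed as the
children of the route split
`DefectDecoherence ⇐ SourceLoopBound ∧ UnstableStarGradient ∧ SignalStarGradient ∧ DressedDefectDecay`:

* `SourceLoopBound` — verbatim the existing item stmt-CriticalPhenomena-8300 of route
  `SAWDevelopingMap` (uniform bound `< sin(π/8)` on the critical returning-loop series at a boundary
  vertex of a simply connected domain; the line's one positive-mass input, rate-free);
* `UnstableStarGradient`, `SignalStarGradient`, `DressedDefectDecay` — the three mass-relative decay
  estimates at a rate `θ > 3/4` (the `∂̄`-difference of the unstable sector `U = A_{-3/8}` over the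
  star, the `∂`-difference of the signal sector `S = A_{5/8}`, the loop dressing `Ā_D − A_D` of the
  defect sector `D = A_{13/8}`).

The three dictionary lemmas `ss_*_iff` certify (by `Iff.rfl`) that the spelled statements ARE the
`Theorems`-level forms `∃ C θ, 3/4 < θ ∧ DecayBound unstableSource C θ` etc. of
`SAWDefectDecoherenceSectorSlavingDefs.lean` (the registered stubs of the live skeleton
`Cruxes/DefectDecoherence/Lines/sector_slaving.lean`), and `defectDecoherence_of_subs` is the split glue
concluding the crux BY NAME.

Sources: H. Duminil-Copin, S. Smirnov, Ann. of Math. 175 (2012) (arXiv:1007.0575), Lemma 1; line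
card `Cruxes/DefectDecoherence/Lines/sector-slaving.md`.
-/

noncomputable section

open scoped BigOperators ComplexConjugate Classical
open Literature.Probability.LatticeModels Literature.Probability.RandomPlanarGeometry.SAW
open Summit.CriticalPhenomena.SAWScalingLimit.Theorems.DefectDecoherence.TipMartingale

namespace Summit.CriticalPhenomena.SAWScalingLimit.Theorems.DefectDecoherence.SectorSlaving

/-- **Dictionary, unstable sector**: the route item `UnstableStarGradient` (spelled over `Literature`
declarations) is definitionally `∃ C θ, 3/4 < θ ∧ DecayBound unstableSource C θ`. [folklore] -/
theorem ss_unstableStarGradient_iff :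
    (∃ C θ : ℝ, 3 / 4 < θ ∧ ∀ (Λ : Finset Literature.Probability.LatticeModels.HexVertex), Literature.Probability.RandomPlanarGeometry.SAW.hexDomainSimplyConnected Λ → ∀ (u w : Literature.Probability.LatticeModels.HexVertex), Literature.Probability.LatticeModels.hexGraph.Adj u w → u ∉ Λ → w ∈ Λ → ∀ (v : Literature.Probability.LatticeModels.HexVertex) (R : ℝ), 1 ≤ R → (∀ y : Literature.Probability.LatticeModels.HexVertex, dist (Literature.Probability.LatticeModels.hexCenter y) (Literature.Probability.LatticeModels.hexCenter v) ≤ R → y ∈ Λ) → ‖∑ t ∈ Λ.filter (fun t => Literature.Probability.LatticeModels.hexGraph.Adj v t), (starRingEnd ℂ ((Literature.Probability.LatticeModels.hexCenter v - Literature.Probability.LatticeModels.hexCenter t) / ((‖Literature.Probability.LatticeModels.hexCenter v - Literature.Probability.LatticeModels.hexCenter t‖ : ℝ) : ℂ))) ^ 2 * ∑ s ∈ Λ.filter (fun q => Literature.Probability.LatticeModels.hexGraph.Adj t q), ∑ γ : Literature.Probability.RandomPlanarGeometry.SAW.HexMidEdgeSAW Λ s(u, w) s(s, t), (if γ.verts.getLast?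 = some s ∧ t ∉ γ.verts then ((Literature.Probability.RandomPlanarGeometry.SAW.hexCriticalFugacity : ℝ) : ℂ) ^ (γ.length + 1) * Complex.exp (-Complex.I * ((-3 / 8 : ℝ) : ℂ) * ((Complex.arg (Literature.Probability.LatticeModels.hexCenter w - Literature.Probability.LatticeModels.hexCenter u) + γ.winding : ℝ) : ℂ)) else 0)‖ ≤ C * R ^ (-θ) * ∑ t ∈ Λ.filter (fun t => Literature.Probability.LatticeModels.hexGraph.Adj v t), ‖Literature.Probability.RandomPlanarGeometry.SAW.hexParafermionicObservable Λ s(u, w) Literature.Probability.RandomPlanarGeometry.SAW.hexCriticalFugacity 0 s(v, t)‖) ↔ (∃ C θ : ℝ, 3 / 4 < θ ∧ DecayBound unstableSource C θ) :=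
  Iff.rfl

/-- **Dictionary, signal sector**: the route item `SignalStarGradient` is definitionally
`∃ C θ, 3/4 < θ ∧ DecayBound signalSource C θ`. [folklore] -/
theorem ss_signalStarGradient_iff :
    (∃ C θ : ℝ, 3 / 4 < θ ∧ ∀ (Λ : Finset Literature.Probability.LatticeModels.HexVertex), Literature.Probability.RandomPlanarGeometry.SAW.hexDomainSimplyConnected Λ → ∀ (u w : Literature.Probability.LatticeModels.HexVertex), Literature.Probability.LatticeModels.hexGraph.Adj u w → u ∉ Λ → w ∈ Λ → ∀ (v : Literature.Probability.LatticeModels.HexVertex) (R : ℝ), 1 ≤ R → (∀ y : Literature.Probability.LatticeModels.HexVertex, dist (Literature.Probability.LatticeModels.hexCenter y) (Literature.Probability.LatticeModels.hexCenter v) ≤ R → y ∈ Λ) → ‖∑ t ∈ Λ.filter (fun t => Literature.Probability.LatticeModels.hexGraph.Adj v t), starRingEnd ℂ ((Literature.Probability.LatticeModels.hexCenter v - Literature.Probability.LatticeModels.hexCenter t) / ((‖Literature.Probability.LatticeModels.hexCenter v - Literature.Probability.LatticeModels.hexCenter t‖ : ℝ) : ℂ)) * ∑ s ∈ Λ.filter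 (fun q => Literature.Probability.LatticeModels.hexGraph.Adj t q), ∑ γ : Literature.Probability.RandomPlanarGeometry.SAW.HexMidEdgeSAW Λ s(u, w) s(s, t), (if γ.verts.getLast? = some s ∧ t ∉ γ.verts then ((Literature.Probability.RandomPlanarGeometry.SAW.hexCriticalFugacity : ℝ) : ℂ) ^ (γ.length + 1) * Complex.exp (-Complex.I * ((5 / 8 : ℝ) : ℂ) * ((Complex.arg (Literature.Probability.LatticeModels.hexCenter w - Literature.Probability.LatticeModels.hexCenter u) + γ.winding : ℝ) : ℂ)) else 0)‖ ≤ C * R ^ (-θ) * ∑ t ∈ Λ.filter (fun t => Literature.Probability.LatticeModels.hexGraph.Adj v t), ‖Literature.Probability.RandomPlanarGeometry.SAW.hexParafermionicObservable Λ s(u, w) Literature.Probability.RandomPlanarGeometry.SAW.hexCriticalFugacity 0 s(v, t)‖) ↔ (∃ C θ : ℝ, 3 / 4 < θ ∧ DecayBound signalSource C θ) :=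
  Iff.rfl

/-- **Dictionary, loop dressing**: the route item `DressedDefectDecay` is definitionally
`∃ C θ, 3/4 < θ ∧ DecayBound dressedDefect C θ`. [folklore] -/
theorem ss_dressedDefectDecay_iff :
    (∃ C θ : ℝ, 3 / 4 < θ ∧ ∀ (Λ : Finset Literature.Probability.LatticeModels.HexVertex), Literature.Probability.RandomPlanarGeometry.SAW.hexDomainSimplyConnected Λ → ∀ (u w : Literature.Probability.LatticeModels.HexVertex), Literature.Probability.LatticeModels.hexGraph.Adj u w → u ∉ Λ → w ∈ Λ → ∀ (v : Literature.Probability.LatticeModels.HexVertex) (R : ℝ), 1 ≤ R → (∀ y : Literature.Probability.LatticeModels.HexVertex, dist (Literature.Probability.LatticeModels.hexCenter y) (Literature.Probability.LatticeModels.hexCenter v) ≤ R → y ∈ Λ) → ‖(∑ s ∈ Λ.filter (fun q => Literature.Probability.LatticeModels.hexGraph.Adj v q), ∑ γ : Literature.Probability.RandomPlanarGeometry.SAW.HexMidEdgeSAW Λ s(u, w) s(s, v), (if γ.verts.getLast? = some s then ((Literature.Probability.RandomPlanarGeometry.SAW.hexCriticalFugacity : ℝ) : ℂ) ^ (γ.length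 + 1) * Complex.exp (-Complex.I * ((13 / 8 : ℝ) : ℂ) * ((Complex.arg (Literature.Probability.LatticeModels.hexCenter w - Literature.Probability.LatticeModels.hexCenter u) + γ.winding : ℝ) : ℂ)) else 0)) - (∑ s ∈ Λ.filter (fun q => Literature.Probability.LatticeModels.hexGraph.Adj v q), ∑ γ : Literature.Probability.RandomPlanarGeometry.SAW.HexMidEdgeSAW Λ s(u, w) s(s, v), (if γ.verts.getLast? = some s ∧ v ∉ γ.verts then ((Literature.Probability.RandomPlanarGeometry.SAW.hexCriticalFugacity : ℝ) : ℂ) ^ (γ.length + 1) * Complex.exp (-Complex.I * ((13 / 8 : ℝ) : ℂ) * ((Complex.arg (Literature.Probability.LatticeModels.hexCenter w - Literature.Probability.LatticeModels.hexCenter u) + γ.winding : ℝ) : ℂ)) else 0))‖ ≤ C * R ^ (-θ) * ∑ t ∈ Λ.filter (fun t => Literature.Probability.LatticeModels.hexGraph.Adj v t), ‖Literature.Probability.RandomPlanarGeometry.SAW.hexParafermionicObservable Λ s(u, w) Literature.Probability.RandomPlanarGeometry.SAW.hexCriticalFugacity 0 s(v, t)‖) ↔ (∃ C θ : ℝ,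 3 / 4 < θ ∧ DecayBound dressedDefect C θ) :=
  Iff.rfl

/-- **The split glue** `SourceLoopBound → UnstableStarGradient → SignalStarGradient →
DressedDefectDecay → DefectDecoherence`, every hypothesis spelled over `Literature` declarations exactly
as filed in the route (`SourceLoopBound` verbatim stmt-CriticalPhenomena-8300), conclusion the crux BY
NAME; it is `defectDecoherence_of_sourceLoopBound_of_sources` read through the dictionary. [folklore] -/
theorem defectDecoherence_of_subs :
    (∃ c : ℝ, c < Real.sin (Real.pi / 8) ∧ ∀ (Λ : Finset Literature.Probability.LatticeModels.HexVertex), Literature.Probability.RandomPlanarGeometry.SAW.hexDomainSimplyConnected Λ → ∀ u v w₁ w₂ : Literature.Probability.LatticeModels.HexVertex, u ∉ Λ → v ∈ Λ → Literature.Probability.LatticeModels.hexGraph.Adj v u → Literature.Probability.LatticeModels.hexGraph.Adj v w₁ → Literature.Probability.LatticeModels.hexGraph.Adj v w₂ → u ≠ w₁ → u ≠ w₂ → w₁ ≠ w₂ → (∑ γ : Literature.Probability.RandomPlanarGeometry.SAW.HexMidEdgeSAW (Λ.erase v) s(v, w₁) s(v, w₂), Literature.Probability.RandomPlanarGeometry.SAW.hexCriticalFugacity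 ^ γ.length) ≤ c) →
    (∃ C θ : ℝ, 3 / 4 < θ ∧ ∀ (Λ : Finset Literature.Probability.LatticeModels.HexVertex), Literature.Probability.RandomPlanarGeometry.SAW.hexDomainSimplyConnected Λ → ∀ (u w : Literature.Probability.LatticeModels.HexVertex), Literature.Probability.LatticeModels.hexGraph.Adj u w → u ∉ Λ → w ∈ Λ → ∀ (v : Literature.Probability.LatticeModels.HexVertex) (R : ℝ), 1 ≤ R → (∀ y : Literature.Probability.LatticeModels.HexVertex, dist (Literature.Probability.LatticeModels.hexCenter y) (Literature.Probability.LatticeModels.hexCenter v) ≤ R → y ∈ Λ) → ‖∑ t ∈ Λ.filter (fun t => Literature.Probability.LatticeModels.hexGraph.Adj v t), (starRingEnd ℂ ((Literature.Probability.LatticeModels.hexCenter v - Literature.Probability.LatticeModels.hexCenter t) / ((‖Literature.Probability.LatticeModels.hexCenter v - Literature.Probability.LatticeModels.hexCenter t‖ : ℝ) : ℂ))) ^ 2 * ∑ s ∈ Λ.filter (fun q => Literature.Probability.LatticeModels.hexGraph.Adj t q), ∑ γ : Literature.Probability.RandomPlanarGeometry.SAW.HexMidEdgeSAW Λ s(u,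 w) s(s, t), (if γ.verts.getLast? = some s ∧ t ∉ γ.verts then ((Literature.Probability.RandomPlanarGeometry.SAW.hexCriticalFugacity : ℝ) : ℂ) ^ (γ.length + 1) * Complex.exp (-Complex.I * ((-3 / 8 : ℝ) : ℂ) * ((Complex.arg (Literature.Probability.LatticeModels.hexCenter w - Literature.Probability.LatticeModels.hexCenter u) + γ.winding : ℝ) : ℂ)) else 0)‖ ≤ C * R ^ (-θ) * ∑ t ∈ Λ.filter (fun t => Literature.Probability.LatticeModels.hexGraph.Adj v t), ‖Literature.Probability.RandomPlanarGeometry.SAW.hexParafermionicObservable Λ s(u, w) Literature.Probability.RandomPlanarGeometry.SAW.hexCriticalFugacity 0 s(v, t)‖) →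
    (∃ C θ : ℝ, 3 / 4 < θ ∧ ∀ (Λ : Finset Literature.Probability.LatticeModels.HexVertex), Literature.Probability.RandomPlanarGeometry.SAW.hexDomainSimplyConnected Λ → ∀ (u w : Literature.Probability.LatticeModels.HexVertex), Literature.Probability.LatticeModels.hexGraph.Adj u w → u ∉ Λ → w ∈ Λ → ∀ (v : Literature.Probability.LatticeModels.HexVertex) (R : ℝ), 1 ≤ R → (∀ y : Literature.Probability.LatticeModels.HexVertex, dist (Literature.Probability.LatticeModels.hexCenter y) (Literature.Probability.LatticeModels.hexCenter v) ≤ R → y ∈ Λ) → ‖∑ t ∈ Λ.filter (fun t => Literature.Probability.LatticeModels.hexGraph.Adj v t), starRingEnd ℂ ((Literature.Probability.LatticeModels.hexCenter v - Literature.Probability.LatticeModels.hexCenter t) / ((‖Literature.Probability.LatticeModels.hexCenter v - Literature.Probability.LatticeModels.hexCenter t‖ : ℝ) : ℂ)) * ∑ s ∈ Λ.filter (fun q => Literature.Probability.LatticeModels.hexGraph.Adj t q), ∑ γ : Literature.Probability.RandomPlanarGeometry.SAW.HexMidEdgeSAW Λ s(u, w) s(s, t), (if γ.verts.getLast? = some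 s ∧ t ∉ γ.verts then ((Literature.Probability.RandomPlanarGeometry.SAW.hexCriticalFugacity : ℝ) : ℂ) ^ (γ.length + 1) * Complex.exp (-Complex.I * ((5 / 8 : ℝ) : ℂ) * ((Complex.arg (Literature.Probability.LatticeModels.hexCenter w - Literature.Probability.LatticeModels.hexCenter u) + γ.winding : ℝ) : ℂ)) else 0)‖ ≤ C * R ^ (-θ) * ∑ t ∈ Λ.filter (fun t => Literature.Probability.LatticeModels.hexGraph.Adj v t), ‖Literature.Probability.RandomPlanarGeometry.SAW.hexParafermionicObservable Λ s(u, w) Literature.Probability.RandomPlanarGeometry.SAW.hexCriticalFugacity 0 s(v, t)‖) →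
    (∃ C θ : ℝ, 3 / 4 < θ ∧ ∀ (Λ : Finset Literature.Probability.LatticeModels.HexVertex), Literature.Probability.RandomPlanarGeometry.SAW.hexDomainSimplyConnected Λ → ∀ (u w : Literature.Probability.LatticeModels.HexVertex), Literature.Probability.LatticeModels.hexGraph.Adj u w → u ∉ Λ → w ∈ Λ → ∀ (v : Literature.Probability.LatticeModels.HexVertex) (R : ℝ), 1 ≤ R → (∀ y : Literature.Probability.LatticeModels.HexVertex, dist (Literature.Probability.LatticeModels.hexCenter y) (Literature.Probability.LatticeModels.hexCenter v) ≤ R → y ∈ Λ) → ‖(∑ s ∈ Λ.filter (fun q => Literature.Probability.LatticeModels.hexGraph.Adj v q), ∑ γ : Literature.Probability.RandomPlanarGeometry.SAW.HexMidEdgeSAW Λ s(u, w) s(s, v), (if γ.verts.getLast? = some s then ((Literature.Probability.RandomPlanarGeometry.SAW.hexCriticalFugacity : ℝ) : ℂ) ^ (γ.length + 1) * Complex.exp (-Complex.I * ((13 / 8 : ℝ) : ℂ) * ((Complex.arg (Literature.Probability.LatticeModels.hexCenter w - Literature.Probability.LatticeModels.hexCenter u) + γ.winding : ℝ) : ℂ))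 else 0)) - (∑ s ∈ Λ.filter (fun q => Literature.Probability.LatticeModels.hexGraph.Adj v q), ∑ γ : Literature.Probability.RandomPlanarGeometry.SAW.HexMidEdgeSAW Λ s(u, w) s(s, v), (if γ.verts.getLast? = some s ∧ v ∉ γ.verts then ((Literature.Probability.RandomPlanarGeometry.SAW.hexCriticalFugacity : ℝ) : ℂ) ^ (γ.length + 1) * Complex.exp (-Complex.I * ((13 / 8 : ℝ) : ℂ) * ((Complex.arg (Literature.Probability.LatticeModels.hexCenter w - Literature.Probability.LatticeModels.hexCenter u) + γ.winding : ℝ) : ℂ)) else 0))‖ ≤ C * R ^ (-θ) * ∑ t ∈ Λ.filter (fun t => Literature.Probability.LatticeModels.hexGraph.Adj v t), ‖Literature.Probability.RandomPlanarGeometry.SAW.hexParafermionicObservable Λ s(u, w) Literature.Probability.RandomPlanarGeometry.SAW.hexCriticalFugacity 0 s(v, t)‖) →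
      Summit.CriticalPhenomena.SAWScalingLimit.Theses.SAWDefectDecoherence.DefectDecoherence :=
  fun hSLB hU hS hD => defectDecoherence_of_sourceLoopBound_of_sources hSLB hU hS hD

end Summit.CriticalPhenomena.SAWScalingLimit.Theorems.DefectDecoherence.SectorSlaving

end
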